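import Literature.Geometry.ComplexHyperbolic.UnitBallLieAlgebraRootJets              -- ★ (a1′) p846492: `integral_blockBoostJet_torusH_eq_zero`, `integral_blockRotJet_torusH_eq_zero`, `isCompact_setOf_conj_torusH_mem_tsupport`; brings ★ (a1), ★ (a0)
import Literature.Geometry.ComplexHyperbolic.UnitBallLieAlgebraCasimirInvariance    -- ★ (b0) p846473: `lieBasis_eq_literal`
import HarnessLib

/-!
# The flat Casimir identity on `𝔲(2,1)`, I: the SECOND DERIVATIVES ALONG THE SIX ROOT DIRECTIONS of the orbital integrand are FIRST derivatives of `Φ_f` along the torus, divided by the root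
# (ROAD «A6-IV» brick (b1), first half; Harish-Chandra 1957 «Differential operators on a semisimple Lie algebra» Thm. 1 for `p = ω`; Helgason GGA Ch. II Thm. 5.? ; Warner II §8.4.1)

Topic `Geometry/ComplexHyperbolic`; namespace `Literature.Geometry.ComplexHyperbolic.BallModel`.  THEOREMS ONLY (no `def`, no instance, no notation, no axiom, no named fact, no `sorry`).
Cell `pub/hodgecm-mathlib`, ENGINE T1 (crux H413 = `stmt-HodgeConjecture-24833`); ROAD A, design of record `DESIGN-A6-InHouse-v2-ArchitectureIV` 93542b84 (LEAD T11-4), SPEC fb65bd65 (b1);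
author F0P3a-p05 (g15) (ROAD A owner), 2026-09-01.

THE MATHEMATICS (`H = torusH θ = diag(iθ)` REGULAR, `Ad_h U = mat h·U·mat h⁻¹`, `f ∈ C^∞_c(M₃(ℂ); E)`, `μ` finite on compacta and right-invariant on `U21`).
§1 THE ROOT-PLANE ALGEBRA at `H` (★ (b0) literal basis): for the noncompact planes `p = 0, 1` (`X = E_{p2}+E_{2p}`, `X′ = i(E_{p2}−E_{2p})`, `P = E_{pp}+E_{22}`, BOOSTS) and the compact plane
(`X = E₀₁−E₁₀`, `X″ = i(E₀₁+E₁₀)`, `P = E₀₀+E₁₁`, ROTATIONS): `[X, H] = ±(θ_j − θ_i)•X′`, `[X′, H] = ±(θ_i − θ_j)•X`, and the second jets `(PH + HP) − 2XHX = 2(θ_p − θ₂)•torusH(e_p − e₂)` (boost),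
`−(PH + HP) − 2XHX = 2(θ₁ − θ₀)•torusH(e₀ − e₁)` (rotation) — the same torus direction for BOTH generators of a plane.
§2 INTEGRABILITY of `h ↦ D²f(Ad_h H)[Ad_h U, Ad_h V]` and `h ↦ Df(Ad_h H)[Ad_h U]` (continuous, supported in the compact carrier ★ (a1′)).
§3 THE SIX IDENTITIES (★ (a1′) jet identities + §1 + bilinearity): for every root direction `E_a` of the plane `{i,j}`,
  **`(θ_i − θ_j) · ∫ D²f(Ad_h H)[Ad_h E_a, Ad_h E_a] dμ(h) = ∓ 2 · ∫ Df(Ad_h H)[Ad_h torusH(e_i − e_j)] dμ(h)`**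
with `−` on the two NONCOMPACT planes and `+` on the COMPACT plane (the sign of `B` on the plane); the right-hand integral is `∂_{e_i−e_j}Φ_f(θ)` by ★ (a1) `iteratedFDeriv_lieOrbital_torusH_apply`.
The sequel (b1, second half) sums these with the weights `w_a = ∓½` of ★ (a0) and the three torus directions (`w = −1`, second derivatives of `Φ_f`) into
`Φ_{∂(ω)f}(θ) = −Δ_θΦ_f − 2Σ_{i<j} ∂_{e_i−e_j}Φ_f∕(θ_i − θ_j) = −π⁻¹Δ_θ(π·Φ_f)`.
HONEST LABEL: HC_CM is proved only modulo the printed citations until rung 0 closes; matrix algebra + bookkeeping over ★ (a1′), pays nothing by itself.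

## References
* [WarnerHASSLG2] G. Warner, *Harmonic Analysis on Semi-Simple Lie Groups II*, Grundlehren 189 (1972), §8.4.1.
* [Helgason2000] S. Helgason, *Groups and Geometric Analysis* (2000), Ch. II §5 (radial part of the Laplacian: `Δ(L_𝔤) = π⁻¹ L_𝔧 ∘ π`).
* [Varadarajan1989] V. S. Varadarajan, *An Introduction to Harmonic Analysis on Semisimple Lie Groups* (1989), §6.3.
-/

set_option autoImplicit false

noncomputable section

namespace Literature.Geometry.ComplexHyperbolic

namespace BallModel

open _root_.Complex _root_.Matrix _root_.MeasureTheory _root_.Set _root_.Filter _root_.Topology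
open scoped Matrix.Norms.Operator ComplexConjugate ContDiff

/-! ## §1 The root-plane algebra at `H = torusH θ` -/

section Algebra

/-- `torusH θ` as a literal matrix. [cite: WarnerHASSLG2, §8.4.1] -/
theorem torusH_eq_literal (θ : Fin 3 → ℝ) : torusH θ = !![((θ 0 : ℝ) : ℂ) * I, 0, 0; 0, ((θ 1 : ℝ) : ℂ) * I, 0; 0, 0, ((θ 2 : ℝ) : ℂ) * I] := by
  ext i j; fin_cases i <;> fin_cases j <;> simp [torusH, Matrix.diagonal]

/-- The torus directions are the first three basis vectors: `torusH e_k = lieBasis k` (`k = 0,1,2`). [cite: WarnerHASSLG2, §8.4.1] -/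
theorem torusH_single_zero : torusH (Pi.single 0 1) = lieBasis 0 := by
  rw [lieBasis_eq_literal, torusH_eq_literal]; ext i j; fin_cases i <;> fin_cases j <;> simp

/-- `torusH e₁ = lieBasis 1`. [cite: WarnerHASSLG2, §8.4.1] -/
theorem torusH_single_one : torusH (Pi.single 1 1) = lieBasis 1 := by
  rw [lieBasis_eq_literal, torusH_eq_literal]; ext i j; fin_cases i <;> fin_cases j <;> simp

/-- `torusH e₂ = lieBasis 2`. [cite: WarnerHASSLG2, §8.4.1] -/
theorem torusH_single_two : torusH (Pi.single 2 1) = lieBasis 2 := by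
  rw [lieBasis_eq_literal, torusH_eq_literal]; ext i j; fin_cases i <;> fin_cases j <;> simp

/-- NONCOMPACT PLANE `{0,2}`: the block data `P = E₀₀+E₂₂`, `X = E₀₂+E₂₀ = lieBasis 5` satisfy the boost relations `P² = P`, `PX = XP = X`, `X² = P`, `Pᴴ = P`, `PJ = JP`, `XᴴJ = −JX`.
[cite: Varadarajan1989, §6.3] -/
theorem boostData_02 :
    (!![1, 0, 0; 0, 0, 0; 0, 0, 1] : Matrix (Fin 3) (Fin 3) ℂ) * !![1, 0, 0; 0, 0, 0; 0, 0, 1] = !![1, 0, 0; 0, 0, 0; 0, 0, 1] ∧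
    (!![1, 0, 0; 0, 0, 0; 0, 0, 1] : Matrix (Fin 3) (Fin 3) ℂ) * lieBasis 5 = lieBasis 5 ∧ lieBasis 5 * (!![1, 0, 0; 0, 0, 0; 0, 0, 1] : Matrix (Fin 3) (Fin 3) ℂ) = lieBasis 5 ∧
    lieBasis 5 * lieBasis 5 = (!![1, 0, 0; 0, 0, 0; 0, 0, 1] : Matrix (Fin 3) (Fin 3) ℂ) ∧ star (!![1, 0, 0; 0, 0, 0; 0, 0, 1] : Matrix (Fin 3) (Fin 3) ℂ) = !![1, 0, 0; 0, 0, 0; 0, 0, 1] ∧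
    (!![1, 0, 0; 0, 0, 0; 0, 0, 1] : Matrix (Fin 3) (Fin 3) ℂ) * J = J * !![1, 0, 0; 0, 0, 0; 0, 0, 1] ∧ star (lieBasis 5) * J = -(J * lieBasis 5) := by
  rw [lieBasis_eq_literal]
  refine ⟨?_, ?_, ?_, ?_, ?_, ?_, ?_⟩ <;> (ext i j; fin_cases i <;> fin_cases j <;> simp [J, Matrix.star_eq_conjTranspose, Matrix.conjTranspose_apply])

/-- NONCOMPACT PLANE `{0,2}`, second generator: `X′ = i(E₀₂−E₂₀) = lieBasis 6` is also a boost generator for `P = E₀₀+E₂₂`. [cite: Varadarajan1989, §6.3] -/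
theorem boostData_02' :
    (!![1, 0, 0; 0, 0, 0; 0, 0, 1] : Matrix (Fin 3) (Fin 3) ℂ) * lieBasis 6 = lieBasis 6 ∧ lieBasis 6 * (!![1, 0, 0; 0, 0, 0; 0, 0, 1] : Matrix (Fin 3) (Fin 3) ℂ) = lieBasis 6 ∧
    lieBasis 6 * lieBasis 6 = (!![1, 0, 0; 0, 0, 0; 0, 0, 1] : Matrix (Fin 3) (Fin 3) ℂ) ∧ star (lieBasis 6) * J = -(J * lieBasis 6) := by
  rw [lieBasis_eq_literal]
  refine ⟨?_, ?_, ?_, ?_⟩ <;> (ext i j; fin_cases i <;> fin_cases j <;> simp [J, Matrix.star_eq_conjTranspose, Matrix.conjTranspose_apply])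

/-- NONCOMPACT PLANE `{1,2}`: `P = E₁₁+E₂₂`, `X = E₁₂+E₂₁ = lieBasis 7` (boost relations). [cite: Varadarajan1989, §6.3] -/
theorem boostData_12 :
    (!![0, 0, 0; 0, 1, 0; 0, 0, 1] : Matrix (Fin 3) (Fin 3) ℂ) * !![0, 0, 0; 0, 1, 0; 0, 0, 1] = !![0, 0, 0; 0, 1, 0; 0, 0, 1] ∧
    (!![0, 0, 0; 0, 1, 0; 0, 0, 1] : Matrix (Fin 3) (Fin 3) ℂ) * lieBasis 7 = lieBasis 7 ∧ lieBasis 7 * (!![0, 0, 0; 0, 1, 0; 0, 0, 1] : Matrix (Fin 3) (Fin 3) ℂ) = lieBasis 7 ∧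
    lieBasis 7 * lieBasis 7 = (!![0, 0, 0; 0, 1, 0; 0, 0, 1] : Matrix (Fin 3) (Fin 3) ℂ) ∧ star (!![0, 0, 0; 0, 1, 0; 0, 0, 1] : Matrix (Fin 3) (Fin 3) ℂ) = !![0, 0, 0; 0, 1, 0; 0, 0, 1] ∧
    (!![0, 0, 0; 0, 1, 0; 0, 0, 1] : Matrix (Fin 3) (Fin 3) ℂ) * J = J * !![0, 0, 0; 0, 1, 0; 0, 0, 1] ∧ star (lieBasis 7) * J = -(J * lieBasis 7) := by
  rw [lieBasis_eq_literal]
  refine ⟨?_, ?_, ?_, ?_, ?_, ?_, ?_⟩ <;> (ext i j; fin_cases i <;> fin_cases j <;> simp [J, Matrix.star_eq_conjTranspose, Matrix.conjTranspose_apply])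

/-- NONCOMPACT PLANE `{1,2}`, second generator `X′ = i(E₁₂−E₂₁) = lieBasis 8`. [cite: Varadarajan1989, §6.3] -/
theorem boostData_12' :
    (!![0, 0, 0; 0, 1, 0; 0, 0, 1] : Matrix (Fin 3) (Fin 3) ℂ) * lieBasis 8 = lieBasis 8 ∧ lieBasis 8 * (!![0, 0, 0; 0, 1, 0; 0, 0, 1] : Matrix (Fin 3) (Fin 3) ℂ) = lieBasis 8 ∧
    lieBasis 8 * lieBasis 8 = (!![0, 0, 0; 0, 1, 0; 0, 0, 1] : Matrix (Fin 3) (Fin 3) ℂ) ∧ star (lieBasis 8) * J = -(J * lieBasis 8) := by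
  rw [lieBasis_eq_literal]
  refine ⟨?_, ?_, ?_, ?_⟩ <;> (ext i j; fin_cases i <;> fin_cases j <;> simp [J, Matrix.star_eq_conjTranspose, Matrix.conjTranspose_apply])

/-- COMPACT PLANE `{0,1}`: `P = E₀₀+E₁₁`, `X = E₀₁−E₁₀ = lieBasis 3` satisfy the ROTATION relations `P² = P`, `PX = XP = X`, `X² = −P`, `Pᴴ = P`, `PJ = JP`, `XᴴJ = −JX`.
[cite: Varadarajan1989, §6.3] -/
theorem rotData_01 :
    (!![1, 0, 0; 0, 1, 0; 0, 0, 0] : Matrix (Fin 3) (Fin 3) ℂ) * !![1, 0, 0; 0, 1, 0; 0, 0, 0] = !![1, 0, 0; 0, 1, 0; 0, 0, 0] ∧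
    (!![1, 0, 0; 0, 1, 0; 0, 0, 0] : Matrix (Fin 3) (Fin 3) ℂ) * lieBasis 3 = lieBasis 3 ∧ lieBasis 3 * (!![1, 0, 0; 0, 1, 0; 0, 0, 0] : Matrix (Fin 3) (Fin 3) ℂ) = lieBasis 3 ∧
    lieBasis 3 * lieBasis 3 = -(!![1, 0, 0; 0, 1, 0; 0, 0, 0] : Matrix (Fin 3) (Fin 3) ℂ) ∧ star (!![1, 0, 0; 0, 1, 0; 0, 0, 0] : Matrix (Fin 3) (Fin 3) ℂ) = !![1, 0, 0; 0, 1, 0; 0, 0, 0] ∧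
    (!![1, 0, 0; 0, 1, 0; 0, 0, 0] : Matrix (Fin 3) (Fin 3) ℂ) * J = J * !![1, 0, 0; 0, 1, 0; 0, 0, 0] ∧ star (lieBasis 3) * J = -(J * lieBasis 3) := by
  rw [lieBasis_eq_literal]
  refine ⟨?_, ?_, ?_, ?_, ?_, ?_, ?_⟩ <;> (ext i j; fin_cases i <;> fin_cases j <;> simp [J, Matrix.star_eq_conjTranspose, Matrix.conjTranspose_apply])

/-- COMPACT PLANE `{0,1}`, second generator `X″ = i(E₀₁+E₁₀) = lieBasis 4` (rotation relations). [cite: Varadarajan1989, §6.3] -/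
theorem rotData_01' :
    (!![1, 0, 0; 0, 1, 0; 0, 0, 0] : Matrix (Fin 3) (Fin 3) ℂ) * lieBasis 4 = lieBasis 4 ∧ lieBasis 4 * (!![1, 0, 0; 0, 1, 0; 0, 0, 0] : Matrix (Fin 3) (Fin 3) ℂ) = lieBasis 4 ∧
    lieBasis 4 * lieBasis 4 = -(!![1, 0, 0; 0, 1, 0; 0, 0, 0] : Matrix (Fin 3) (Fin 3) ℂ) ∧ star (lieBasis 4) * J = -(J * lieBasis 4) := by
  rw [lieBasis_eq_literal]
  refine ⟨?_, ?_, ?_, ?_⟩ <;> (ext i j; fin_cases i <;> fin_cases j <;> simp [J, Matrix.star_eq_conjTranspose, Matrix.conjTranspose_apply])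

/-- THE COMMUTATORS WITH `H = torusH θ`: `[E₅, H] = (θ₂−θ₀)•E₆`, `[E₆, H] = (θ₀−θ₂)•E₅`, `[E₇, H] = (θ₂−θ₁)•E₈`, `[E₈, H] = (θ₁−θ₂)•E₇`, `[E₃, H] = (θ₁−θ₀)•E₄`, `[E₄, H] = (θ₀−θ₁)•E₃`
(`ad H` rotates each root plane by its root). [cite: WarnerHASSLG2, §8.4.1] -/
theorem lieBasis_comm_torusH (θ : Fin 3 → ℝ) :
    lieBasis 5 * torusH θ - torusH θ * lieBasis 5 = (θ 2 - θ 0) • lieBasis 6 ∧ lieBasis 6 * torusH θ - torusH θ * lieBasis 6 = (θ 0 - θ 2) • lieBasis 5 ∧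
    lieBasis 7 * torusH θ - torusH θ * lieBasis 7 = (θ 2 - θ 1) • lieBasis 8 ∧ lieBasis 8 * torusH θ - torusH θ * lieBasis 8 = (θ 1 - θ 2) • lieBasis 7 ∧
    lieBasis 3 * torusH θ - torusH θ * lieBasis 3 = (θ 1 - θ 0) • lieBasis 4 ∧ lieBasis 4 * torusH θ - torusH θ * lieBasis 4 = (θ 0 - θ 1) • lieBasis 3 := by
  rw [lieBasis_eq_literal, torusH_eq_literal]
  refine ⟨?_, ?_, ?_, ?_, ?_, ?_⟩ <;> (ext i j; fin_cases i <;> fin_cases j <;> simp <;> apply Complex.ext <;> simp <;> ring)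

/-- THE SECOND JET, noncompact plane `{0,2}`, boost generator `E₅`: `(PH + HP) − 2E₅HE₅ = 2(θ₀ − θ₂)•torusH(e₀ − e₂)` — a TORUS direction. [cite: WarnerHASSLG2, §8.4.1] -/
theorem secondJet_five (θ : Fin 3 → ℝ) :
    (!![1, 0, 0; 0, 0, 0; 0, 0, 1] : Matrix (Fin 3) (Fin 3) ℂ) * torusH θ + torusH θ * !![1, 0, 0; 0, 0, 0; 0, 0, 1] - (2 : ℂ) • (lieBasis 5 * torusH θ * lieBasis 5) =
      (2 * (θ 0 - θ 2)) • torusH (Pi.single 0 1 - Pi.single 2 1) := by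
  rw [lieBasis_eq_literal, torusH_eq_literal, torusH_eq_literal]
  ext i j; fin_cases i <;> fin_cases j <;> simp <;> apply Complex.ext <;> simp <;> ring

/-- THE SECOND JET, noncompact plane `{0,2}`, boost generator `E₆`: the same torus direction — a TORUS direction. [cite: WarnerHASSLG2, §8.4.1] -/
theorem secondJet_six (θ : Fin 3 → ℝ) :
    (!![1, 0, 0; 0, 0, 0; 0, 0, 1] : Matrix (Fin 3) (Fin 3) ℂ) * torusH θ + torusH θ * !![1, 0, 0; 0, 0, 0; 0, 0, 1] - (2 : ℂ) • (lieBasis 6 * torusH θ * lieBasis 6) =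
      (2 * (θ 0 - θ 2)) • torusH (Pi.single 0 1 - Pi.single 2 1) := by
  rw [lieBasis_eq_literal, torusH_eq_literal, torusH_eq_literal]
  ext i j; fin_cases i <;> fin_cases j <;> simp <;> apply Complex.ext <;> simp <;> ring

/-- THE SECOND JET, noncompact plane `{1,2}`, boost generator `E₇`: `2(θ₁ − θ₂)•torusH(e₁ − e₂)` — a TORUS direction. [cite: WarnerHASSLG2, §8.4.1] -/
theorem secondJet_seven (θ : Fin 3 → ℝ) :
    (!![0, 0, 0; 0, 1, 0; 0, 0, 1] : Matrix (Fin 3) (Fin 3) ℂ) * torusH θ + torusH θ * !![0, 0, 0; 0, 1, 0; 0, 0, 1] - (2 : ℂ) • (lieBasis 7 * torusH θ * lieBasis 7) =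
      (2 * (θ 1 - θ 2)) • torusH (Pi.single 1 1 - Pi.single 2 1) := by
  rw [lieBasis_eq_literal, torusH_eq_literal, torusH_eq_literal]
  ext i j; fin_cases i <;> fin_cases j <;> simp <;> apply Complex.ext <;> simp <;> ring

/-- THE SECOND JET, noncompact plane `{1,2}`, boost generator `E₈` — a TORUS direction. [cite: WarnerHASSLG2, §8.4.1] -/
theorem secondJet_eight (θ : Fin 3 → ℝ) :
    (!![0, 0, 0; 0, 1, 0; 0, 0, 1] : Matrix (Fin 3) (Fin 3) ℂ) * torusH θ + torusH θ * !![0, 0, 0; 0, 1, 0; 0, 0, 1] - (2 : ℂ) • (lieBasis 8 * torusH θ * lieBasis 8) =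
      (2 * (θ 1 - θ 2)) • torusH (Pi.single 1 1 - Pi.single 2 1) := by
  rw [lieBasis_eq_literal, torusH_eq_literal, torusH_eq_literal]
  ext i j; fin_cases i <;> fin_cases j <;> simp <;> apply Complex.ext <;> simp <;> ring

/-- THE SECOND JET, compact plane `{0,1}`, rotation generator `E₃`: `−(PH + HP) − 2E₃HE₃ = 2(θ₁ − θ₀)•torusH(e₀ − e₁)` — a TORUS direction. [cite: WarnerHASSLG2, §8.4.1] -/
theorem secondJet_three (θ : Fin 3 → ℝ) :
    -((!![1, 0, 0; 0, 1, 0; 0, 0, 0] : Matrix (Fin 3) (Fin 3) ℂ) * torusH θ + torusH θ * !![1, 0, 0; 0, 1, 0; 0, 0, 0]) - (2 : ℂ) • (lieBasis 3 * torusH θ * lieBasis 3) =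
      (2 * (θ 1 - θ 0)) • torusH (Pi.single 0 1 - Pi.single 1 1) := by
  rw [lieBasis_eq_literal, torusH_eq_literal, torusH_eq_literal]
  ext i j; fin_cases i <;> fin_cases j <;> simp <;> apply Complex.ext <;> simp <;> ring

/-- THE SECOND JET, compact plane `{0,1}`, rotation generator `E₄` — a TORUS direction. [cite: WarnerHASSLG2, §8.4.1] -/
theorem secondJet_four (θ : Fin 3 → ℝ) :
    -((!![1, 0, 0; 0, 1, 0; 0, 0, 0] : Matrix (Fin 3) (Fin 3) ℂ) * torusH θ + torusH θ * !![1, 0, 0; 0, 1, 0; 0, 0, 0]) - (2 : ℂ) • (lieBasis 4 * torusH θ * lieBasis 4) =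
      (2 * (θ 1 - θ 0)) • torusH (Pi.single 0 1 - Pi.single 1 1) := by
  rw [lieBasis_eq_literal, torusH_eq_literal, torusH_eq_literal]
  ext i j; fin_cases i <;> fin_cases j <;> simp <;> apply Complex.ext <;> simp <;> ring

end Algebra

/-! ## §2 Integrability of the first and second derivatives along conjugated directions -/

section Integrable

variable {E : Type*} [NormedAddCommGroup E] [NormedSpace ℝ E] [CompleteSpace E]

omit [CompleteSpace E] in
/-- `h ↦ D²f(Ad_h H)[Ad_h U, Ad_h V]` is continuous for `f ∈ C^∞`. [cite: Varadarajan1989, §6.3] -/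
theorem continuous_fderiv_two_conj {f : Matrix (Fin 3) (Fin 3) ℂ → E} (hf : ContDiff ℝ ∞ f) (H U V : Matrix (Fin 3) (Fin 3) ℂ) :
    Continuous fun h : U21 => fderiv ℝ (fderiv ℝ f) (mat h * H * mat h⁻¹) (mat h * U * mat h⁻¹) (mat h * V * mat h⁻¹) := by
  have hconj : ∀ M : Matrix (Fin 3) (Fin 3) ℂ, Continuous fun h : U21 => mat h * M * mat h⁻¹ := fun M =>
    (continuous_mat.mul continuous_const).mul (continuous_mat.comp continuous_inv)
  have hD2 : Continuous (fderiv ℝ (fderiv ℝ f)) := ((hf.fderiv_right (m := ∞) le_rfl).fderiv_right (m := ∞) le_rfl).continuous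
  exact ((hD2.comp (hconj H)).clm_apply (hconj U)).clm_apply (hconj V)

omit [CompleteSpace E] in
/-- `h ↦ Df(Ad_h H)[Ad_h U]` is continuous for `f ∈ C^∞`. [cite: Varadarajan1989, §6.3] -/
theorem continuous_fderiv_conj {f : Matrix (Fin 3) (Fin 3) ℂ → E} (hf : ContDiff ℝ ∞ f) (H U : Matrix (Fin 3) (Fin 3) ℂ) :
    Continuous fun h : U21 => fderiv ℝ f (mat h * H * mat h⁻¹) (mat h * U * mat h⁻¹) := by
  have hconj : ∀ M : Matrix (Fin 3) (Fin 3) ℂ, Continuous fun h : U21 => mat h * M * mat h⁻¹ := fun M =>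
    (continuous_mat.mul continuous_const).mul (continuous_mat.comp continuous_inv)
  have hD : Continuous (fderiv ℝ f) := (hf.fderiv_right (m := ∞) le_rfl).continuous
  exact (hD.comp (hconj H)).clm_apply (hconj U)

omit [CompleteSpace E] in
/-- **Integrability of `h ↦ D²f(Ad_h torusH θ)[Ad_h U, Ad_h V]`** off the noncompact walls (continuous, supported in the compact carrier ★ (a1′)). [cite: WarnerHASSLG2, §8.4.1] -/
theorem integrable_fderiv_two_conj_torusH (μ : Measure U21) [IsFiniteMeasureOnCompacts μ] {f : Matrix (Fin 3) (Fin 3) ℂ → E} (hf : ContDiff ℝ ∞ f) (hfc : HasCompactSupport f)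
    (θ : Fin 3 → ℝ) (h02 : θ 0 ≠ θ 2) (h12 : θ 1 ≠ θ 2) (U V : Matrix (Fin 3) (Fin 3) ℂ) :
    Integrable (fun h : U21 => fderiv ℝ (fderiv ℝ f) (mat h * torusH θ * mat h⁻¹) (mat h * U * mat h⁻¹) (mat h * V * mat h⁻¹)) μ := by
  refine (continuous_fderiv_two_conj hf (torusH θ) U V).integrable_of_hasCompactSupport ?_
  refine HasCompactSupport.intro (isCompact_setOf_conj_torusH_mem_tsupport hfc θ h02 h12) fun h hh => ?_
  have hh₁ : mat h * torusH θ * mat h⁻¹ ∉ tsupport (fderiv ℝ f) := fun hm => hh (tsupport_fderiv_subset ℝ (f := f) hm)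
  have hh₂ : mat h * torusH θ * mat h⁻¹ ∉ tsupport (fderiv ℝ (fderiv ℝ f)) := fun hm => hh₁ (tsupport_fderiv_subset ℝ (f := fderiv ℝ f) hm)
  have hzero : fderiv ℝ (fderiv ℝ f) (mat h * torusH θ * mat h⁻¹) = 0 := image_eq_zero_of_notMem_tsupport hh₂
  simp only [hzero, FunLike.coe_zero, Pi.zero_apply]

omit [CompleteSpace E] in
/-- **Integrability of `h ↦ Df(Ad_h torusH θ)[Ad_h U]`** off the noncompact walls. [cite: WarnerHASSLG2, §8.4.1] -/
theorem integrable_fderiv_conj_torusH (μ : Measure U21) [IsFiniteMeasureOnCompacts μ] {f : Matrix (Fin 3) (Fin 3) ℂ → E} (hf : ContDiff ℝ ∞ f) (hfc : HasCompactSupport f)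
    (θ : Fin 3 → ℝ) (h02 : θ 0 ≠ θ 2) (h12 : θ 1 ≠ θ 2) (U : Matrix (Fin 3) (Fin 3) ℂ) :
    Integrable (fun h : U21 => fderiv ℝ f (mat h * torusH θ * mat h⁻¹) (mat h * U * mat h⁻¹)) μ := by
  refine (continuous_fderiv_conj hf (torusH θ) U).integrable_of_hasCompactSupport ?_
  refine HasCompactSupport.intro (isCompact_setOf_conj_torusH_mem_tsupport hfc θ h02 h12) fun h hh => ?_
  have hh' : mat h * torusH θ * mat h⁻¹ ∉ tsupport (fderiv ℝ f) := fun hm => hh ((tsupport_fderiv_subset ℝ) hm)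
  rw [image_eq_zero_of_notMem_tsupport hh', FunLike.coe_zero, Pi.zero_apply]

end Integrable

/-! ## §3 The six root identities -/

section RootIdentities

variable {E : Type*} [NormedAddCommGroup E] [NormedSpace ℝ E] [CompleteSpace E]

omit [CompleteSpace E] in
/-- **THE ABSTRACT STEP**: from a jet identity `∫ [D²f(Ad H)(Ad C)² + Df(Ad H)(Ad C₂)] = 0` with `C = c•Y` and `C₂ = c₂•T`, both integrands separately integrable:
`c² · ∫ D²f(Ad H)[Ad Y, Ad Y] = −c₂ · ∫ Df(Ad H)[Ad T]` (real bilinearity). [cite: Varadarajan1989, §6.3] -/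
theorem sq_mul_integral_fderiv_two_eq_of_jet (μ : Measure U21) {f : Matrix (Fin 3) (Fin 3) ℂ → E} (H C C₂ Y T : Matrix (Fin 3) (Fin 3) ℂ) (c c₂ : ℝ)
    (hC : C = c • Y) (hC₂ : C₂ = c₂ • T)
    (hA : Integrable (fun h : U21 => fderiv ℝ (fderiv ℝ f) (mat h * H * mat h⁻¹) (mat h * Y * mat h⁻¹) (mat h * Y * mat h⁻¹)) μ)
    (hB : Integrable (fun h : U21 => fderiv ℝ f (mat h * H * mat h⁻¹) (mat h * T * mat h⁻¹)) μ)
    (hjet : ∫ h : U21, (fderiv ℝ (fderiv ℝ f) (mat h * H * mat h⁻¹) (mat h * C * mat h⁻¹) (mat h * C * mat h⁻¹) +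
        fderiv ℝ f (mat h * H * mat h⁻¹) (mat h * C₂ * mat h⁻¹)) ∂μ = 0) :
    c ^ 2 • ∫ h : U21, fderiv ℝ (fderiv ℝ f) (mat h * H * mat h⁻¹) (mat h * Y * mat h⁻¹) (mat h * Y * mat h⁻¹) ∂μ =
      -(c₂ • ∫ h : U21, fderiv ℝ f (mat h * H * mat h⁻¹) (mat h * T * mat h⁻¹) ∂μ) := by
  have hconjC : ∀ h : U21, mat h * C * mat h⁻¹ = c • (mat h * Y * mat h⁻¹) := fun h => by rw [hC, Matrix.mul_smul, Matrix.smul_mul]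
  have hconjC₂ : ∀ h : U21, mat h * C₂ * mat h⁻¹ = c₂ • (mat h * T * mat h⁻¹) := fun h => by rw [hC₂, Matrix.mul_smul, Matrix.smul_mul]
  have hpt : ∀ h : U21, fderiv ℝ (fderiv ℝ f) (mat h * H * mat h⁻¹) (mat h * C * mat h⁻¹) (mat h * C * mat h⁻¹) +
      fderiv ℝ f (mat h * H * mat h⁻¹) (mat h * C₂ * mat h⁻¹) =
        c ^ 2 • fderiv ℝ (fderiv ℝ f) (mat h * H * mat h⁻¹) (mat h * Y * mat h⁻¹) (mat h * Y * mat h⁻¹) + c₂ • fderiv ℝ f (mat h * H * mat h⁻¹) (mat h * T * mat h⁻¹) := by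
    intro h
    rw [hconjC, hconjC₂, ContinuousLinearMap.map_smul, ContinuousLinearMap.map_smul, _root_.smul_apply, ContinuousLinearMap.map_smul, smul_smul, pow_two]
  simp_rw [hpt] at hjet
  have hA' : Integrable (fun h : U21 => c ^ 2 • fderiv ℝ (fderiv ℝ f) (mat h * H * mat h⁻¹) (mat h * Y * mat h⁻¹) (mat h * Y * mat h⁻¹)) μ := hA.smul (c ^ 2)
  have hB' : Integrable (fun h : U21 => c₂ • fderiv ℝ f (mat h * H * mat h⁻¹) (mat h * T * mat h⁻¹)) μ := hB.smul c₂
  rw [integral_add hA' hB', integral_smul, integral_smul] at hjet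
  exact eq_neg_of_add_eq_zero_left hjet

/-- **NONCOMPACT PLANE `{0,2}`, direction `E₆ = i(E₀₂−E₂₀)`** (boost along `E₅`): `(θ₂−θ₀)² · ∫ D²f(Ad H)[Ad E₆]² = −2(θ₀−θ₂) · ∫ Df(Ad H)[Ad torusH(e₀−e₂)]`.
[cite: Helgason2000, Ch. II §5] [cite: Varadarajan1989, §6.3] -/
theorem rootIdentity_six (μ : Measure U21) [IsFiniteMeasureOnCompacts μ] [μ.IsMulRightInvariant] {f : Matrix (Fin 3) (Fin 3) ℂ → E} (hf : ContDiff ℝ ∞ f)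
    (hfc : HasCompactSupport f) (θ : Fin 3 → ℝ) (h02 : θ 0 ≠ θ 2) (h12 : θ 1 ≠ θ 2) :
    (θ 2 - θ 0) ^ 2 • ∫ h : U21, fderiv ℝ (fderiv ℝ f) (mat h * torusH θ * mat h⁻¹) (mat h * lieBasis 6 * mat h⁻¹) (mat h * lieBasis 6 * mat h⁻¹) ∂μ =
      -((2 * (θ 0 - θ 2)) • ∫ h : U21, fderiv ℝ f (mat h * torusH θ * mat h⁻¹) (mat h * torusH (Pi.single 0 1 - Pi.single 2 1) * mat h⁻¹) ∂μ) := by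
  obtain ⟨hPP, hPX, hXP, hXX, hPs, hPJ, hXJ⟩ := boostData_02
  have hjet := (integral_blockBoostJet_torusH_eq_zero μ f (hf.of_le (WithTop.coe_le_coe.mpr le_top)) hfc (lieBasis 5) _ hPP hPX hXP hXX hPs hPJ hXJ θ h02 h12 rfl).2
  exact sq_mul_integral_fderiv_two_eq_of_jet μ _ _ _ _ _ _ _ (lieBasis_comm_torusH θ).1 (secondJet_five θ)
    (integrable_fderiv_two_conj_torusH μ hf hfc θ h02 h12 _ _) (integrable_fderiv_conj_torusH μ hf hfc θ h02 h12 _) hjet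

/-- **NONCOMPACT PLANE `{0,2}`, direction `E₅ = E₀₂+E₂₀`** (boost along `E₆`): `(θ₀−θ₂)² · ∫ D²f(Ad H)[Ad E₅]² = −2(θ₀−θ₂) · ∫ Df(Ad H)[Ad torusH(e₀−e₂)]`.
[cite: Helgason2000, Ch. II §5] [cite: Varadarajan1989, §6.3] -/
theorem rootIdentity_five (μ : Measure U21) [IsFiniteMeasureOnCompacts μ] [μ.IsMulRightInvariant] {f : Matrix (Fin 3) (Fin 3) ℂ → E} (hf : ContDiff ℝ ∞ f)
    (hfc : HasCompactSupport f) (θ : Fin 3 → ℝ) (h02 : θ 0 ≠ θ 2) (h12 : θ 1 ≠ θ 2) :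
    (θ 0 - θ 2) ^ 2 • ∫ h : U21, fderiv ℝ (fderiv ℝ f) (mat h * torusH θ * mat h⁻¹) (mat h * lieBasis 5 * mat h⁻¹) (mat h * lieBasis 5 * mat h⁻¹) ∂μ =
      -((2 * (θ 0 - θ 2)) • ∫ h : U21, fderiv ℝ f (mat h * torusH θ * mat h⁻¹) (mat h * torusH (Pi.single 0 1 - Pi.single 2 1) * mat h⁻¹) ∂μ) := by
  obtain ⟨hPP, -, -, -, hPs, hPJ, -⟩ := boostData_02
  obtain ⟨hPX, hXP, hXX, hXJ⟩ := boostData_02'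
  have hjet := (integral_blockBoostJet_torusH_eq_zero μ f (hf.of_le (WithTop.coe_le_coe.mpr le_top)) hfc (lieBasis 6) _ hPP hPX hXP hXX hPs hPJ hXJ θ h02 h12 rfl).2
  exact sq_mul_integral_fderiv_two_eq_of_jet μ _ _ _ _ _ _ _ (lieBasis_comm_torusH θ).2.1 (secondJet_six θ)
    (integrable_fderiv_two_conj_torusH μ hf hfc θ h02 h12 _ _) (integrable_fderiv_conj_torusH μ hf hfc θ h02 h12 _) hjet

/-- **NONCOMPACT PLANE `{1,2}`, direction `E₈ = i(E₁₂−E₂₁)`** (boost along `E₇`): `(θ₂−θ₁)² · ∫ D²f(Ad H)[Ad E₈]² = −2(θ₁−θ₂) · ∫ Df(Ad H)[Ad torusH(e₁−e₂)]`.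
[cite: Helgason2000, Ch. II §5] [cite: Varadarajan1989, §6.3] -/
theorem rootIdentity_eight (μ : Measure U21) [IsFiniteMeasureOnCompacts μ] [μ.IsMulRightInvariant] {f : Matrix (Fin 3) (Fin 3) ℂ → E} (hf : ContDiff ℝ ∞ f)
    (hfc : HasCompactSupport f) (θ : Fin 3 → ℝ) (h02 : θ 0 ≠ θ 2) (h12 : θ 1 ≠ θ 2) :
    (θ 2 - θ 1) ^ 2 • ∫ h : U21, fderiv ℝ (fderiv ℝ f) (mat h * torusH θ * mat h⁻¹) (mat h * lieBasis 8 * mat h⁻¹) (mat h * lieBasis 8 * mat h⁻¹) ∂μ =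
      -((2 * (θ 1 - θ 2)) • ∫ h : U21, fderiv ℝ f (mat h * torusH θ * mat h⁻¹) (mat h * torusH (Pi.single 1 1 - Pi.single 2 1) * mat h⁻¹) ∂μ) := by
  obtain ⟨hPP, hPX, hXP, hXX, hPs, hPJ, hXJ⟩ := boostData_12
  have hjet := (integral_blockBoostJet_torusH_eq_zero μ f (hf.of_le (WithTop.coe_le_coe.mpr le_top)) hfc (lieBasis 7) _ hPP hPX hXP hXX hPs hPJ hXJ θ h02 h12 rfl).2
  exact sq_mul_integral_fderiv_two_eq_of_jet μ _ _ _ _ _ _ _ (lieBasis_comm_torusH θ).2.2.1 (secondJet_seven θ)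
    (integrable_fderiv_two_conj_torusH μ hf hfc θ h02 h12 _ _) (integrable_fderiv_conj_torusH μ hf hfc θ h02 h12 _) hjet

/-- **NONCOMPACT PLANE `{1,2}`, direction `E₇ = E₁₂+E₂₁`** (boost along `E₈`): `(θ₁−θ₂)² · ∫ D²f(Ad H)[Ad E₇]² = −2(θ₁−θ₂) · ∫ Df(Ad H)[Ad torusH(e₁−e₂)]`.
[cite: Helgason2000, Ch. II §5] [cite: Varadarajan1989, §6.3] -/
theorem rootIdentity_seven (μ : Measure U21) [IsFiniteMeasureOnCompacts μ] [μ.IsMulRightInvariant] {f : Matrix (Fin 3) (Fin 3) ℂ → E} (hf : ContDiff ℝ ∞ f)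
    (hfc : HasCompactSupport f) (θ : Fin 3 → ℝ) (h02 : θ 0 ≠ θ 2) (h12 : θ 1 ≠ θ 2) :
    (θ 1 - θ 2) ^ 2 • ∫ h : U21, fderiv ℝ (fderiv ℝ f) (mat h * torusH θ * mat h⁻¹) (mat h * lieBasis 7 * mat h⁻¹) (mat h * lieBasis 7 * mat h⁻¹) ∂μ =
      -((2 * (θ 1 - θ 2)) • ∫ h : U21, fderiv ℝ f (mat h * torusH θ * mat h⁻¹) (mat h * torusH (Pi.single 1 1 - Pi.single 2 1) * mat h⁻¹) ∂μ) := by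
  obtain ⟨hPP, -, -, -, hPs, hPJ, -⟩ := boostData_12
  obtain ⟨hPX, hXP, hXX, hXJ⟩ := boostData_12'
  have hjet := (integral_blockBoostJet_torusH_eq_zero μ f (hf.of_le (WithTop.coe_le_coe.mpr le_top)) hfc (lieBasis 8) _ hPP hPX hXP hXX hPs hPJ hXJ θ h02 h12 rfl).2
  exact sq_mul_integral_fderiv_two_eq_of_jet μ _ _ _ _ _ _ _ (lieBasis_comm_torusH θ).2.2.2.1 (secondJet_eight θ)
    (integrable_fderiv_two_conj_torusH μ hf hfc θ h02 h12 _ _) (integrable_fderiv_conj_torusH μ hf hfc θ h02 h12 _) hjet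

/-- **COMPACT PLANE `{0,1}`, direction `E₄ = i(E₀₁+E₁₀)`** (rotation along `E₃`): `(θ₁−θ₀)² · ∫ D²f(Ad H)[Ad E₄]² = −2(θ₁−θ₀) · ∫ Df(Ad H)[Ad torusH(e₀−e₁)]`.
[cite: Helgason2000, Ch. II §5] [cite: Varadarajan1989, §6.3] -/
theorem rootIdentity_four (μ : Measure U21) [IsFiniteMeasureOnCompacts μ] [μ.IsMulRightInvariant] {f : Matrix (Fin 3) (Fin 3) ℂ → E} (hf : ContDiff ℝ ∞ f)
    (hfc : HasCompactSupport f) (θ : Fin 3 → ℝ) (h02 : θ 0 ≠ θ 2) (h12 : θ 1 ≠ θ 2) :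
    (θ 1 - θ 0) ^ 2 • ∫ h : U21, fderiv ℝ (fderiv ℝ f) (mat h * torusH θ * mat h⁻¹) (mat h * lieBasis 4 * mat h⁻¹) (mat h * lieBasis 4 * mat h⁻¹) ∂μ =
      -((2 * (θ 1 - θ 0)) • ∫ h : U21, fderiv ℝ f (mat h * torusH θ * mat h⁻¹) (mat h * torusH (Pi.single 0 1 - Pi.single 1 1) * mat h⁻¹) ∂μ) := by
  obtain ⟨hPP, hPX, hXP, hXX, hPs, hPJ, hXJ⟩ := rotData_01
  have hjet := (integral_blockRotJet_torusH_eq_zero μ f (hf.of_le (WithTop.coe_le_coe.mpr le_top)) hfc (lieBasis 3) _ hPP hPX hXP hXX hPs hPJ hXJ θ h02 h12 rfl).2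
  exact sq_mul_integral_fderiv_two_eq_of_jet μ _ _ _ _ _ _ _ (lieBasis_comm_torusH θ).2.2.2.2.1 (secondJet_three θ)
    (integrable_fderiv_two_conj_torusH μ hf hfc θ h02 h12 _ _) (integrable_fderiv_conj_torusH μ hf hfc θ h02 h12 _) hjet

/-- **COMPACT PLANE `{0,1}`, direction `E₃ = E₀₁−E₁₀`** (rotation along `E₄`): `(θ₀−θ₁)² · ∫ D²f(Ad H)[Ad E₃]² = −2(θ₁−θ₀) · ∫ Df(Ad H)[Ad torusH(e₀−e₁)]`.
[cite: Helgason2000, Ch. II §5] [cite: Varadarajan1989, §6.3] -/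
theorem rootIdentity_three (μ : Measure U21) [IsFiniteMeasureOnCompacts μ] [μ.IsMulRightInvariant] {f : Matrix (Fin 3) (Fin 3) ℂ → E} (hf : ContDiff ℝ ∞ f)
    (hfc : HasCompactSupport f) (θ : Fin 3 → ℝ) (h02 : θ 0 ≠ θ 2) (h12 : θ 1 ≠ θ 2) :
    (θ 0 - θ 1) ^ 2 • ∫ h : U21, fderiv ℝ (fderiv ℝ f) (mat h * torusH θ * mat h⁻¹) (mat h * lieBasis 3 * mat h⁻¹) (mat h * lieBasis 3 * mat h⁻¹) ∂μ =
      -((2 * (θ 1 - θ 0)) • ∫ h : U21, fderiv ℝ f (mat h * torusH θ * mat h⁻¹) (mat h * torusH (Pi.single 0 1 - Pi.single 1 1) * mat h⁻¹) ∂μ) := by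
  obtain ⟨hPP, -, -, -, hPs, hPJ, -⟩ := rotData_01
  obtain ⟨hPX, hXP, hXX, hXJ⟩ := rotData_01'
  have hjet := (integral_blockRotJet_torusH_eq_zero μ f (hf.of_le (WithTop.coe_le_coe.mpr le_top)) hfc (lieBasis 4) _ hPP hPX hXP hXX hPs hPJ hXJ θ h02 h12 rfl).2
  exact sq_mul_integral_fderiv_two_eq_of_jet μ _ _ _ _ _ _ _ (lieBasis_comm_torusH θ).2.2.2.2.2 (secondJet_four θ)
    (integrable_fderiv_two_conj_torusH μ hf hfc θ h02 h12 _ _) (integrable_fderiv_conj_torusH μ hf hfc θ h02 h12 _) hjet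

end RootIdentities

end BallModel

end Literature.Geometry.ComplexHyperbolic

end
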